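import Literature.NumberTheory.Automorphic.BCDTTheoremACasesProofs
import Literature.NumberTheory.Automorphic.CDTTheorem712OggThreeTwoProofs
import Literature.NumberTheory.Automorphic.CDTTheorem722
import HarnessLib

/-!
# BCDT Theorem A by the three cases of the Introduction, on the finer leaves of the tree:
# Ogg's formula for `V₂` at `p = 3`, and CDT Theorem 7.2.2 split into lifting and (3) ⇒ (2)

Topic `NumberTheory/Automorphic`; a `…Proofs` companion (theorems only: no definitions, no named
facts, no instances) of `Literature.NumberTheory.Automorphic.BCDTTheoremACasesProofs`, landed by the
tenured seat of the named fact `Literature.NumberTheory.Automorphic.exists_cuspForm_coeff_eq_frobeniusTrace`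
(**lang.S33**, the weak `a_p`-form of the Modularity Theorem) to keep the switch-free assembly of
that fact on the finest inputs the tree currently offers.

C. Breuil, B. Conrad, F. Diamond, R. Taylor, *On the modularity of elliptic curves over `ℚ`: wild
`3`-adic exercises*, J. Amer. Math. Soc. 14 (2001), 843–939 [BCDTJAMS2001], prove **Theorem A** in
their Introduction by three cases (case 1: `ρ̄_{E,5}|_{ℚ(√5)}` irreducible — Theorem B, then [CDT];
case 2: `ρ̄_{E,3}|_{ℚ(√-3)}` absolutely irreducible — Langlands–Tunnell, then [CDT]; case 3: the three
exceptional `j`-invariants, [CDT] with Elkies), and *"In each of cases 1 and 2 there are two steps.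
First we prove that `ρ̄_{E,ℓ}` is modular and then that `ρ_{E,ℓ}` is modular."*
`BCDTTheoremACasesProofs` renders this for one curve as
`BCDT.isModular_of_theoremB_of_CDT721_722_723` (Theorem B, CDT Thm. 7.2.1, Thm. 7.2.2, Lemma 7.2.3,
and the per-curve input `h27`: "`ρ̄_{E,5}|_{ℚ(√5)}` not absolutely irreducible ⇒ `27 ∤ N_E`"), with
`h27` discharged there from Ogg's formula for the wild conductor of the **`5`-adic** Tate module at
the additive places of residue characteristic `3`.  Two finer inputs have since landed:

* `CDTTheorem712OggThreeTwoProofs` proves the hidden lemma `h27` from Ogg's formula for the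
  **`2`-adic** Tate module at those places
  (`WeierstrassCurve.swanConductorAt_rationalTate_eq_wildConductorExponent_of_ringChar_eq_three · 2`,
  the statement Silverman, *ATAEC* §IV.11 actually proves for `p = 3`, PDF pp. 366–371, with
  `L = K(E[2])`), through the `ℓ`-independence of tameness of `V_ℓ E`
  (`not_dvd_conductorNorm_of_not_isAbsIrreducibleOverSqrt_of_ogg3two`); its Theorem-A assemblies on
  that input carry either the `3`–`5` switch (`…_switch_of_ogg3two`) or the Shepherd-Barron–Taylor
  auxiliary curve (`…_of_wild_of_auxiliaryCurve_…_of_ogg3two`).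
* `CDTTheorem722` splits CDT Thm. 7.2.2 into its two printed steps — the `5`-adic lifting statement
  `hlift` ("`ρ̄_{E,5}` modular, `ρ̄_{E,5}|_{ℚ(√5)}` absolutely irreducible ⇒ `ρ_{E,5}` modular",
  CDT pp. 553–554) and BCDT's (3) ⇒ (2) `h32` ("`ρ_{E,5}` modular ⇒ `E` modular"; Carayol, Faltings)
  — `CDT_theorem_7_2_2_of_lift_of_three_imp_two`; this is exactly the two-step structure BCDT print
  for case 1.

This file composes them with the three-cases theorem (every proof is a one-line application; nothing
is restated, no definition or named fact is introduced):

* `BCDT.isModular_of_theoremB_of_CDT721_722_723_of_ogg3two` — Theorem A for one curve on Ogg's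
  formula for `V₂` at `p = 3`; `BCDT.CDT_theorem_7_2_4_of_theoremB_of_7_2_1_of_7_2_2_of_7_2_3_of_ogg3two`;
  `BCDT.exists_isNewformOf_of_theoremB_of_CDT721_722_723_of_ogg3two` (Theorem A) and its variant
  `…_of_leaf_two` on the unsplit leaf `…_of_ringChar_eq · 2` of `HasseWeilAbelianConductor`;
* `BCDT.isModular_of_theoremB_of_CDT721_lift_32_723`,
  `BCDT.exists_isNewformOf_of_theoremB_of_CDT721_lift_32_723_of_ogg3two` — the same with Thm. 7.2.2
  unfolded into `hlift` and `h32`;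
* `BCDT.exists_isNewformOf_of_serre_of_CDT721_722_723_of_ogg3two` — Theorem B replaced by Serre's
  conjecture at `p = 5` (`theoremB_of_exists_newform_of_odd_irreducible`, `BCDTModularitySerreProofs`);
* the lang.S33 corollaries `exists_cuspForm_coeff_eq_frobeniusTrace_of_theoremB_of_CDT721_722_723_of_ogg3two`,
  `…_of_theoremB_of_CDT721_lift_32_723_of_ogg3two`, `…_of_serre_of_CDT721_722_723_of_ogg3two` and
  the `L`-series form `exists_cuspForm_qExpansion_coeff_eq_lFunction_of_theoremB_of_CDT721_722_723_of_ogg3two`.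

Trust base of lang.S33 (and of `exists_isNewformOf`) inside the tree with Theorem B kept whole,
after this file: {`BCDT.theoremB`, `BCDT.CDT_theorem_7_2_1`, `BCDT.CDT_theorem_7_2_2` — or its two
steps `hlift`, `h32` —, `BCDT.CDT_lemma_7_2_3_isModular`, Ogg's formula at `p = 3` for `ℓ = 2`}:
no `3`–`5` switch, no auxiliary curve, and the Galois-side input is the printed-and-proved
statement of *ATAEC*.

## References

* [BCDTJAMS2001] C. Breuil, B. Conrad, F. Diamond, R. Taylor, J. Amer. Math. Soc. 14 (2001),
  843–939: Theorem A and the three cases of its proof (Introduction, p. 845), Theorem B,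
  conditions (1)–(4) and "(3) ⇒ (2)" (Introduction, p. 845), Thm. 2.2.2 (p. 862).
* [ConradDiamondTaylor1999] B. Conrad, F. Diamond, R. Taylor, J. Amer. Math. Soc. 12 (1999),
  521–567: Thm. 7.2.1, Thm. 7.2.2 and its proof (pp. 553–554), Lemma 7.2.3 (p. 554), Thm. 7.2.4
  (p. 556).
* [SilvermanATAEC1994] J. H. Silverman, *Advanced Topics in the Arithmetic of Elliptic Curves*,
  §IV.11 (Ogg's formula, proof for `p = 3`, PDF pp. 366–371).

## Design

Pure theorems; `noncomputable section`; namespaces `Literature.NumberTheory.Automorphic.BCDT`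
(next to the facts it serves) and `Literature.NumberTheory.Automorphic` (the lang.S33 corollaries,
next to `LangWave0Proofs`); no instances, no `sorry`. Axioms of every theorem: `propext`,
`Classical.choice`, `Quot.sound`.
-/

noncomputable section

open scoped MatrixGroups

namespace Literature.NumberTheory.Automorphic.BCDT

open EllipticCurves.ModularForms WeierstrassCurve GaloisRepresentations

/-! ## Theorem A with Theorem B granted, on Ogg's formula for `V₂` at `p = 3` -/

/-- **BCDT Theorem A for a given `E / ℚ`, the three cases of the Introduction, on Ogg's formula for
the `2`-adic Tate module at the additive places of residue characteristic `3`**: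
`isModular_of_theoremB_of_CDT721_722_723` (`BCDTTheoremACasesProofs`) with its input `h27`
("`ρ̄_{E,5}|_{ℚ(√5)}` not absolutely irreducible ⇒ `27 ∤ N_E`") discharged by
`not_dvd_conductorNorm_of_not_isAbsIrreducibleOverSqrt_of_ogg3two` (`CDTTheorem712OggThreeTwoProofs`:
from `Sw_𝔓(V₂ E) = δ_v(E)` at the places of residue characteristic `3`, the `ℓ`-independence of
tameness, the element of order `3` in the image of `ρ̄_{E,5}` and the Weil pairing).  Granted
Theorem B, CDT Thm. 7.2.1, Thm. 7.2.2 and Lemma 7.2.3 (modularity); no `3`–`5` switch.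
[cite: BCDTJAMS2001, Introduction (proof of Theorem A, cases 1–3)] -/
theorem isModular_of_theoremB_of_CDT721_722_723_of_ogg3two (hB : theoremB)
    (h721 : CDT_theorem_7_2_1) (h722 : CDT_theorem_7_2_2) (h723 : CDT_lemma_7_2_3_isModular)
    (W : WeierstrassCurve ℚ) [W.IsElliptic] [NeZero (W.conductorNorm ℤ)]
    (hOgg3two : W.swanConductorAt_rationalTate_eq_wildConductorExponent_of_ringChar_eq_three 2) :
    IsModular W :=
  isModular_of_theoremB_of_CDT721_722_723 hB h721 h722 h723 W fun _ hρ h5 ↦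
    not_dvd_conductorNorm_of_not_isAbsIrreducibleOverSqrt_of_ogg3two W hOgg3two hρ h5

/-- **Conrad–Diamond–Taylor 1999, Theorem 7.2.4** (the named fact `CDT_theorem_7_2_4` of
`BCDTModularity`) **from Theorem B, CDT Thm. 7.2.1, Thm. 7.2.2, Lemma 7.2.3 and Ogg's formula for
`V₂` at `p = 3`**: `CDT_theorem_7_2_4_of_7_1_2_of_7_2_2_of_ogg3two` (`CDTTheorem712OggThreeTwoProofs`:
7.2.4 "immediate from Theorem 7.1.2", p. 556) applied to the switch-free
`CDT_theorem_7_1_2_of_theoremB_of_7_2_1_of_7_2_2_of_7_2_3` (`BCDTTheoremACasesProofs`).  Compare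
`CDT_theorem_7_2_4_of_7_2_1_of_7_2_2_of_7_2_3_of_switch_of_ogg3two` (the `3`–`5` switch as input).
[cite: ConradDiamondTaylor1999, Thm. 7.2.4 (p. 556)] -/
theorem CDT_theorem_7_2_4_of_theoremB_of_7_2_1_of_7_2_2_of_7_2_3_of_ogg3two (hB : theoremB)
    (h721 : CDT_theorem_7_2_1) (h722 : CDT_theorem_7_2_2) (h723 : CDT_lemma_7_2_3_isModular)
    (hOgg3two : ∀ W : WeierstrassCurve ℚ,
      W.swanConductorAt_rationalTate_eq_wildConductorExponent_of_ringChar_eq_three 2) :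
    CDT_theorem_7_2_4 :=
  CDT_theorem_7_2_4_of_7_1_2_of_7_2_2_of_ogg3two
    (CDT_theorem_7_1_2_of_theoremB_of_7_2_1_of_7_2_2_of_7_2_3 hB h721 h722 h723) h722 hOgg3two

/-- **BCDT Theorem A** (`Literature.NumberTheory.EllipticCurves.ModularForms.exists_isNewformOf`, the
Modularity Theorem in the tree's form) **from Theorem B, CDT Thm. 7.2.1, Thm. 7.2.2, Lemma 7.2.3
(modularity) and Ogg's formula for the `2`-adic Tate module at the additive places of residue
characteristic `3`** — the three cases of BCDT's Introduction for every curve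
(`isModular_of_theoremB_of_CDT721_722_723_of_ogg3two`).  Trust base of the Modularity Theorem inside
the tree with Theorem B kept whole, after this theorem: {`theoremB`, `CDT_theorem_7_2_1`,
`CDT_theorem_7_2_2`, `CDT_lemma_7_2_3_isModular`,
`WeierstrassCurve.swanConductorAt_rationalTate_eq_wildConductorExponent_of_ringChar_eq_three · 2`};
neither the `3`–`5` switch of `exists_isNewformOf_of_theoremB_of_CDT721_722_723_switch_of_ogg3two` nor
the auxiliary curve of `exists_isNewformOf_of_wild_of_auxiliaryCurve_of_CDT721_722_723_of_ogg3two`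
(`CDTTheorem712OggThreeTwoProofs`) is an input. [cite: BCDTJAMS2001, Theorem A] -/
theorem exists_isNewformOf_of_theoremB_of_CDT721_722_723_of_ogg3two (hB : theoremB)
    (h721 : CDT_theorem_7_2_1) (h722 : CDT_theorem_7_2_2) (h723 : CDT_lemma_7_2_3_isModular)
    (hOgg3two : ∀ W : WeierstrassCurve ℚ,
      W.swanConductorAt_rationalTate_eq_wildConductorExponent_of_ringChar_eq_three 2) :
    EllipticCurves.ModularForms.exists_isNewformOf :=
  fun W _ _ ↦ isModular_of_theoremB_of_CDT721_722_723_of_ogg3two hB h721 h722 h723 W (hOgg3two W)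

/-- The same assembly of **Theorem A** on the unsplit leaf of `HasseWeilAbelianConductor` at `ℓ = 2`
(`WeierstrassCurve.swanConductorAt_rationalTate_eq_wildConductorExponent_of_ringChar_eq · 2`: Ogg's
formula for `V₂` at the additive places of residue characteristic `2` or `3`; at `ℓ = 2` its `p = 2`
half is vacuous), which specialises to the `p = 3` input
(`swanConductorAt_rationalTate_eq_wildConductorExponent_of_ringChar_eq_three_of_ringChar_eq`), as in
`CDT_theorem_7_2_4_of_7_2_1_of_7_2_2_of_7_2_3_of_switch_of_leaf_two`. [cite: BCDTJAMS2001, Theorem A] -/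
theorem exists_isNewformOf_of_theoremB_of_CDT721_722_723_of_leaf_two (hB : theoremB)
    (h721 : CDT_theorem_7_2_1) (h722 : CDT_theorem_7_2_2) (h723 : CDT_lemma_7_2_3_isModular)
    (hW23 : ∀ W : WeierstrassCurve ℚ,
      W.swanConductorAt_rationalTate_eq_wildConductorExponent_of_ringChar_eq 2) :
    EllipticCurves.ModularForms.exists_isNewformOf :=
  exists_isNewformOf_of_theoremB_of_CDT721_722_723_of_ogg3two hB h721 h722 h723 fun W ↦
    W.swanConductorAt_rationalTate_eq_wildConductorExponent_of_ringChar_eq_three_of_ringChar_eq 2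
      (hW23 W)

/-! ## The same with CDT Theorem 7.2.2 unfolded into its two printed steps -/

/-- **BCDT, proof of Theorem A for a given `E / ℚ`, with the two steps of case 1 spelled out**
(Introduction: *"In each of cases 1 and 2 there are two steps. First we prove that `ρ̄_{E,ℓ}` is
modular and then that `ρ_{E,ℓ}` is modular. In case 1 this first step is our Theorem B … the
deduction of the modularity of `ρ_{E,ℓ}` from that of `ρ̄_{E,ℓ}` was carried out in [CDT]"*, and
*"(3) ⇒ (2) follows from a theorem of Carayol [Ca1] and a theorem of Faltings [Fa2]"*):
`isModular_of_theoremB_of_CDT721_722_723` with CDT Thm. 7.2.2 supplied by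
`CDT_theorem_7_2_2_of_lift_of_three_imp_two` (`CDTTheorem722`) from the `5`-adic lifting statement
`hlift` (`ρ̄_{E,5}` modular and `ρ̄_{E,5}|_{ℚ(√5)}` absolutely irreducible ⇒ `ρ_{E,5}` modular,
`WeierstrassCurve.IsModularGaloisRepTate`; CDT Thm. 7.2.2, proof, pp. 553–554) and (3) ⇒ (2) at
`ℓ = 5`, `h32` (`ρ_{E,5}` modular ⇒ `E` modular).  The per-curve input `h27` is as there.
[cite: BCDTJAMS2001, Introduction (proof of Theorem A, cases 1–3; (3) ⇒ (2))]
[cite: ConradDiamondTaylor1999, Thm. 7.2.2 (proof, pp. 553–554)] -/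
theorem isModular_of_theoremB_of_CDT721_lift_32_723 (hB : theoremB) (h721 : CDT_theorem_7_2_1)
    (hlift : ∀ (W : WeierstrassCurve ℚ) [W.IsElliptic] (ρ : ModPGaloisRep ℚ (ZMod 5) 2),
      W.IsTorsionGaloisRep 5 ρ → ρ.IsAbsIrreducibleOverSqrt 5 → ρ.IsModular →
      W.IsModularGaloisRepTate 5)
    (h32 : ∀ (W : WeierstrassCurve ℚ) [W.IsElliptic] [NeZero (W.conductorNorm ℤ)],
      W.IsModularGaloisRepTate 5 → IsModular W)
    (h723 : CDT_lemma_7_2_3_isModular)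
    (W : WeierstrassCurve ℚ) [W.IsElliptic] [NeZero (W.conductorNorm ℤ)]
    (h27 : ∀ ρ : ModPGaloisRep ℚ (ZMod 5) 2, W.IsTorsionGaloisRep 5 ρ →
      ¬ ρ.IsAbsIrreducibleOverSqrt 5 → ¬ 27 ∣ W.conductorNorm ℤ) :
    IsModular W :=
  isModular_of_theoremB_of_CDT721_722_723 hB h721
    (CDT_theorem_7_2_2_of_lift_of_three_imp_two hlift h32) h723 W h27

/-- **BCDT Theorem A from Theorem B, CDT Thm. 7.2.1, the `5`-adic lifting step of CDT Thm. 7.2.2,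
(3) ⇒ (2) at `ℓ = 5`, CDT Lemma 7.2.3 (modularity) and Ogg's formula for `V₂` at `p = 3`**:
`exists_isNewformOf_of_theoremB_of_CDT721_722_723_of_ogg3two` with `CDT_theorem_7_2_2` discharged by
`CDT_theorem_7_2_2_of_lift_of_three_imp_two`.  Compare
`exists_isNewformOf_of_wild_of_auxiliaryCurve_of_CDT721_lift_32_723_of_swan` (`CDTTheorem722`), which
decomposes Theorem B instead and runs on Ogg's formula at `ℓ = 5` in wild form.
[cite: BCDTJAMS2001, Theorem A; Introduction (proof of Theorem A)] -/
theorem exists_isNewformOf_of_theoremB_of_CDT721_lift_32_723_of_ogg3two (hB : theoremB)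
    (h721 : CDT_theorem_7_2_1)
    (hlift : ∀ (W : WeierstrassCurve ℚ) [W.IsElliptic] (ρ : ModPGaloisRep ℚ (ZMod 5) 2),
      W.IsTorsionGaloisRep 5 ρ → ρ.IsAbsIrreducibleOverSqrt 5 → ρ.IsModular →
      W.IsModularGaloisRepTate 5)
    (h32 : ∀ (W : WeierstrassCurve ℚ) [W.IsElliptic] [NeZero (W.conductorNorm ℤ)],
      W.IsModularGaloisRepTate 5 → IsModular W)
    (h723 : CDT_lemma_7_2_3_isModular)
    (hOgg3two : ∀ W : WeierstrassCurve ℚ,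
      W.swanConductorAt_rationalTate_eq_wildConductorExponent_of_ringChar_eq_three 2) :
    EllipticCurves.ModularForms.exists_isNewformOf :=
  exists_isNewformOf_of_theoremB_of_CDT721_722_723_of_ogg3two hB h721
    (CDT_theorem_7_2_2_of_lift_of_three_imp_two hlift h32) h723 hOgg3two

/-! ## Theorem B replaced by Serre's conjecture at `p = 5` -/

/-- **Theorem A from Serre's conjecture (3.2.3) at `p = 5` in place of Theorem B**, CDT Thm. 7.2.1,
Thm. 7.2.2, Lemma 7.2.3 (modularity) and Ogg's formula for `V₂` at `p = 3`: Theorem B is the case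
`p = 5`, `k = 𝔽₅ ⊂ 𝔽̄₅` of the named fact `exists_newform_of_odd_irreducible` (`SerreConjecture`;
Serre (3.2.3), Khare–Wintenberger 2009, Thm. 1.2) by `theoremB_of_exists_newform_of_odd_irreducible`
(`BCDTModularitySerreProofs`; BCDT, Introduction: *"Serre had earlier conjectured that ["`ρ̄`
irreducible ⇒ `ρ̄` modular"] holds"*).  Alternative trust base: {Serre at `p = 5`, CDT 7.2.1,
7.2.2, 7.2.3 (modularity), Ogg at `p = 3` for `ℓ = 2`}.
[cite: BCDTJAMS2001, Introduction; Theorem A] -/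
theorem exists_isNewformOf_of_serre_of_CDT721_722_723_of_ogg3two
    (hSerre : ∀ (k : Type) [Field k] [TopologicalSpace k] [DiscreteTopology k],
      exists_newform_of_odd_irreducible (p := 5) (k := k))
    (h721 : CDT_theorem_7_2_1) (h722 : CDT_theorem_7_2_2) (h723 : CDT_lemma_7_2_3_isModular)
    (hOgg3two : ∀ W : WeierstrassCurve ℚ,
      W.swanConductorAt_rationalTate_eq_wildConductorExponent_of_ringChar_eq_three 2) :
    EllipticCurves.ModularForms.exists_isNewformOf :=
  exists_isNewformOf_of_theoremB_of_CDT721_722_723_of_ogg3two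
    (theoremB_of_exists_newform_of_odd_irreducible hSerre) h721 h722 h723 hOgg3two

end Literature.NumberTheory.Automorphic.BCDT

namespace Literature.NumberTheory.Automorphic

open WeierstrassCurve GaloisRepresentations

/-! ## lang.S33 with Theorem B granted, on Ogg's formula for `V₂` at `p = 3`: no switch -/

/-- **lang.S33 from Theorem B, CDT Thms. 7.2.1, 7.2.2, Lemma 7.2.3 (modularity) and Ogg's formula
for the `2`-adic Tate module at the additive places of residue characteristic `3`** — by the three
cases of BCDT's Introduction, without the `3`–`5` switch or an auxiliary curve: granted those five
inputs, every integral Weierstrass model `E` with `Δ_E ≠ 0` has a level `N ≥ 1` and a cusp form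
`f ∈ S₂(Γ₀(N))` with `a_p(f) = p + 1 - #E(𝔽_p)` for every prime `p ∤ N Δ_E`
(`exists_cuspForm_coeff_eq_frobeniusTrace_of_exists_isNewformOf`, `LangWave0Proofs` Part 2, applied
to `BCDT.exists_isNewformOf_of_theoremB_of_CDT721_722_723_of_ogg3two`).  Compare
`exists_cuspForm_coeff_eq_frobeniusTrace_of_theoremB_of_CDT721_722_723_switch_of_ogg3two`
(`CDTTheorem712OggThreeTwoProofs`), which carries the switch as a sixth input, and
`exists_cuspForm_coeff_eq_frobeniusTrace_of_theoremB_of_CDT721_722_723_of_ogg3`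
(`BCDTTheoremACasesProofs`), on Ogg's formula for `V₅`.
[cite: BCDTJAMS2001, Theorem A; Introduction (proof of Theorem A, cases 1–3)] -/
theorem exists_cuspForm_coeff_eq_frobeniusTrace_of_theoremB_of_CDT721_722_723_of_ogg3two
    (hB : BCDT.theoremB) (h721 : BCDT.CDT_theorem_7_2_1) (h722 : BCDT.CDT_theorem_7_2_2)
    (h723 : BCDT.CDT_lemma_7_2_3_isModular)
    (hOgg3two : ∀ W : WeierstrassCurve ℚ,
      W.swanConductorAt_rationalTate_eq_wildConductorExponent_of_ringChar_eq_three 2) :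
    exists_cuspForm_coeff_eq_frobeniusTrace :=
  exists_cuspForm_coeff_eq_frobeniusTrace_of_exists_isNewformOf
    (BCDT.exists_isNewformOf_of_theoremB_of_CDT721_722_723_of_ogg3two hB h721 h722 h723 hOgg3two)

/-- **lang.S33, `L`-series form** (`exists_cuspForm_qExpansion_coeff_eq_lFunction`: some
`f ∈ S₂(Γ₀(N))`, `N ≥ 1`, with `aₙ(f) = aₙ(E)` for all `n`) **from the same five inputs**
(`exists_cuspForm_qExpansion_coeff_eq_lFunction_of_exists_isNewformOf`, `LangWave0Proofs` Part 4,
applied to `BCDT.exists_isNewformOf_of_theoremB_of_CDT721_722_723_of_ogg3two`).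
[cite: BCDTJAMS2001, Theorem A and Introduction (2)] -/
theorem exists_cuspForm_qExpansion_coeff_eq_lFunction_of_theoremB_of_CDT721_722_723_of_ogg3two
    (hB : BCDT.theoremB) (h721 : BCDT.CDT_theorem_7_2_1) (h722 : BCDT.CDT_theorem_7_2_2)
    (h723 : BCDT.CDT_lemma_7_2_3_isModular)
    (hOgg3two : ∀ W : WeierstrassCurve ℚ,
      W.swanConductorAt_rationalTate_eq_wildConductorExponent_of_ringChar_eq_three 2) :
    exists_cuspForm_qExpansion_coeff_eq_lFunction :=
  exists_cuspForm_qExpansion_coeff_eq_lFunction_of_exists_isNewformOf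
    (BCDT.exists_isNewformOf_of_theoremB_of_CDT721_722_723_of_ogg3two hB h721 h722 h723 hOgg3two)

/-- **lang.S33 from Theorem B, CDT Thm. 7.2.1, the `5`-adic lifting step of CDT Thm. 7.2.2,
(3) ⇒ (2) at `ℓ = 5`, CDT Lemma 7.2.3 (modularity) and Ogg's formula for `V₂` at `p = 3`**
(`BCDT.exists_isNewformOf_of_theoremB_of_CDT721_lift_32_723_of_ogg3two`): the two steps of case 1
of BCDT's Introduction ("first … `ρ̄_{E,ℓ}` is modular and then … `ρ_{E,ℓ}` is modular") and
"(3) ⇒ (2)" made explicit. [cite: BCDTJAMS2001, Theorem A; Introduction (proof of Theorem A)] -/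
theorem exists_cuspForm_coeff_eq_frobeniusTrace_of_theoremB_of_CDT721_lift_32_723_of_ogg3two
    (hB : BCDT.theoremB) (h721 : BCDT.CDT_theorem_7_2_1)
    (hlift : ∀ (W : WeierstrassCurve ℚ) [W.IsElliptic] (ρ : ModPGaloisRep ℚ (ZMod 5) 2),
      W.IsTorsionGaloisRep 5 ρ → ρ.IsAbsIrreducibleOverSqrt 5 → ρ.IsModular →
      W.IsModularGaloisRepTate 5)
    (h32 : ∀ (W : WeierstrassCurve ℚ) [W.IsElliptic] [NeZero (W.conductorNorm ℤ)],
      W.IsModularGaloisRepTate 5 → BCDT.IsModular W)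
    (h723 : BCDT.CDT_lemma_7_2_3_isModular)
    (hOgg3two : ∀ W : WeierstrassCurve ℚ,
      W.swanConductorAt_rationalTate_eq_wildConductorExponent_of_ringChar_eq_three 2) :
    exists_cuspForm_coeff_eq_frobeniusTrace :=
  exists_cuspForm_coeff_eq_frobeniusTrace_of_exists_isNewformOf
    (BCDT.exists_isNewformOf_of_theoremB_of_CDT721_lift_32_723_of_ogg3two hB h721 hlift h32 h723
      hOgg3two)

/-- **lang.S33 from Serre's conjecture (3.2.3) at `p = 5`, CDT Thms. 7.2.1, 7.2.2, Lemma 7.2.3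
(modularity) and Ogg's formula for `V₂` at `p = 3`** (Theorem B replaced by
Serre–Khare–Wintenberger at `p = 5`, `BCDT.exists_isNewformOf_of_serre_of_CDT721_722_723_of_ogg3two`).
[cite: BCDTJAMS2001, Theorem A; Introduction] -/
theorem exists_cuspForm_coeff_eq_frobeniusTrace_of_serre_of_CDT721_722_723_of_ogg3two
    (hSerre : ∀ (k : Type) [Field k] [TopologicalSpace k] [DiscreteTopology k],
      exists_newform_of_odd_irreducible (p := 5) (k := k))
    (h721 : BCDT.CDT_theorem_7_2_1) (h722 : BCDT.CDT_theorem_7_2_2)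
    (h723 : BCDT.CDT_lemma_7_2_3_isModular)
    (hOgg3two : ∀ W : WeierstrassCurve ℚ,
      W.swanConductorAt_rationalTate_eq_wildConductorExponent_of_ringChar_eq_three 2) :
    exists_cuspForm_coeff_eq_frobeniusTrace :=
  exists_cuspForm_coeff_eq_frobeniusTrace_of_exists_isNewformOf
    (BCDT.exists_isNewformOf_of_serre_of_CDT721_722_723_of_ogg3two hSerre h721 h722 h723 hOgg3two)

end Literature.NumberTheory.Automorphic

end
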